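import Literature.MathematicalPhysics.QuantumFieldTheory.Balaban1983to89.B8IdxB8SubDPeriodicTowers
import Literature.MathematicalPhysics.QuantumFieldTheory.Balaban1983to89.B8Eq113ClassBk

/-!
# `Balaban1983to89.B8PeriodicMemberGeometry` — [Balaban1985RegularSpaces] p. 76 (1.2) («p_{μν}(x)»), p. 77 (the conventions «a bond belongs to Ω», «on Ω_j», (1.3)–(1.6), «Ω_j ⊂ T_η»):
# THE MEMBER GEOMETRY OF [B8]'S TYPED TEXTS TRANSLATES UNDER THE PERIOD LATTICE — every SITE-keyed geometric predicate the member model `zdGF3` reads (`BondTouches`, `PlaqTouches`,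
# `IsSide`, `SideTouches`, the mask of the canonical exponent `mlogCfg`) is invariant under `y ↦ y + T•m` when the set is `T`-periodic, and every LEVEL-`l`-LABEL-keyed one (`bondsOn`,
# `EndBlockIn`, `towerBondsP`) under `z ↦ z + Q•m` when `T = Lˡ·Q`

statement-level skeleton of published theorems with citation tags; proofs where landed; nothing here is a claim about the Yang–Mills mass gap

T. Bałaban, *Spaces of regular gauge field configurations on a lattice and gauge fixing conditions*, Commun. Math. Phys. **99** (1985) 75–102 `[Balaban1985RegularSpaces]`
— (1.2) p. 76, p. 77 (bond ∕ plaquette conventions, (1.3)–(1.6), «Ω_j ⊂ T_η», «we admit … Ω_j = T_η»), (1.31) ∕ (1.37) p. 82, p. 86 («𝔅_k»), (1.145) p. 100.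

WHY (cell pub-ymgap, N05 [B8]; director-ym №217 (β′-PERIODIC) road; plan g86 PENS-217; width seat dag-n05-w2 g6 CLAIM-3 = OFFER-1 taken by the P1 pen dag-n05-c, WORD-5 2026-08-28 13:48Z: «the ONE
P1-side use I foresee is `isPeriodic_mlogCfg` — at a member with `P`-periodic `Ω_j` the CANONICAL masked exponent `B8LeafModelZd3.mlogCfg k η Ω U₁` of a periodic `U₁` is periodic — which needs exactly
`SideTouches (Ω j) (b.1 + (P:ℤ)•m) b.2 ↔ SideTouches (Ω j) b.1 b.2`»; the `towerBondsP ∕ EndBlockIn ∕ bondsOn` items serve the P4 re-key's periodic use-site lemmas).  The FIELD-level covariance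
(`avgIter ∕ mgauge ∕ logCfg` under `shiftCfg`) is in `B7TranslationCovariance` ∕ `B7AvgPeriodicity` ∕ `B12Ineq417Flat`; `isPeriodic_mlogCfg` itself is P1's (`B8LeafModelZdPer` v1.2) on top of this file.

WHAT IS PROVED (0 `def`, 0 sorry; std axioms) — periodicity predicate of record `T4TermwiseTorus.IsPeriodic T (· ∈ S)` (the law of `Node00.IdxB8SubDPer`), `Iff` bookkeeping only:
* §1 sites ∕ bonds ∕ plaquettes: `bondTouches_add_zsmul_iff`, `plaqTouches_add_zsmul_iff`, `isSide_add_iff` (any translation), ★ `sideTouches_add_zsmul_iff`, `isPeriodic_sideTouches`,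
  ★ `sideTouchesMask_add_zsmul_iff` ∕ `isPeriodic_sideTouchesMask` (the mask `∃ j, j ≤ k ∧ SideTouches (Ω j) y τ` of `B8LeafModelZd3.mlogCfg`, from `∀ j ≤ k, IsPeriodic T (· ∈ Ω j)`),
  `bondsOn_add_zsmul_iff` (`B8Eq113ClassBk.bondsOn Λ l`, label period).
* §2 blocks (label shift `Q`, fine period `T = Lˡ·Q`): `tlo_add_zsmul` ∕ `thi_add_zsmul`, `forall_inBox_tower_add_iff`, ★ `endBlockIn_add_zsmul_iff` (`B8LeafModelZd3P.EndBlockIn`), ★ `towerBondsP_add_zsmul_iff` ∕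
  `isPeriodic_towerBondsP` (`B8TowerBondsPrinted.towerBondsP`; `Ω_l`, `Ω_{l−1}` `T`-periodic, `Λ l` `Q`-periodic, `Λ (l−1)` `L·Q`-periodic), `isPeriodic_towerBondsP_lam` (at `Λ := B11Eq7Convention.Lam L Ω m`, from
  the Ω-periods alone).
* §3 on the index of record: `IdxB8SubD.towerBondsP_Λs_add_zsmul_iff` ∕ `IdxB8SubD.isPeriodic_towerBondsP_Λs` (at a (1.5)-member, from the Ω-periods via p636487's `IdxB8SubD.isPeriodic_Λs`).

HONEST FRAMING: lattice bookkeeping; NO estimate; nothing of Bałaban's asserted or refuted; no model ∕ index ∕ pin ∕ door typed; count-neutral; N05 NOT discharged; one finite 𝕋⁴ programme at fixed ε, Bałaban AS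
PRINTED — NOT continuum ∕ ℝ⁴ ∕ OS ∕ mass gap ∕ Clay.  No `sorry`, no `instance`, no `notation`. -/

noncomputable section

namespace Literature.MathematicalPhysics.QuantumFieldTheory.Balaban1983to89.B8PeriodicMemberGeometry

open B7Prop1Explicit B7Prop1Local
open B8Ineq132 (BondTouches PlaqTouches)
open B8Ineq130 (tlo thi)
open B8Eq140Level (IsSide SideTouches)
open B8Eq113ClassBk (bondsOn mem_bondsOn)
open B8Thm2LogB (blockTop)
open B8LeafModelZd3P (EndBlockIn)
open B8TowerBondsPrinted (towerBondsP)
open T4TermwiseTorus (IsPeriodic)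
open B8IdxB8SubDPeriodicTowers (isPeriodic_mem_iff isPeriodic_mem_of_iff isPeriodic_mem_sub_iff forall_inBox_add_iff forall_block_add_iff loK_add_zsmul bondHiK_add_zsmul
  smul_add_zsmul isPeriodic_lamK)
open Node00 (Stage3Params IdxB8SubD)

variable {d : ℕ}

/-! ## §1 Sites, bonds, plaquettes: translation by the period lattice `Tℤᵈ` -/

section Sites

/-- `x + v + e_μ = (x + e_μ) + v` (private bookkeeping). [folklore] -/
private theorem add_right_comm_e (x v : B7Prop1Explicit.Site d) (μ : Fin d) : x + v + e μ = x + e μ + v := add_right_comm _ _ _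

/-- «The bond `⟨x, x + e_μ⟩` belongs to `S`» translates: `BondTouches S (x + T•m) μ ↔ BondTouches S x μ` for a `T`-periodic `S`. [cite: Balaban1985RegularSpaces, p.77 («a bond b belongs to Ω if at least one of its end-points belongs to Ω»)] -/
theorem bondTouches_add_zsmul_iff {T : ℕ} {S : Set (B7Prop1Explicit.Site d)} (hS : IsPeriodic T (· ∈ S)) (x m : B7Prop1Explicit.Site d) (μ : Fin d) :
    BondTouches S (x + (T : ℤ) • m) μ ↔ BondTouches S x μ := by
  unfold BondTouches
  rw [add_right_comm_e, isPeriodic_mem_iff hS, isPeriodic_mem_iff hS]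

/-- «The plaquette `p_{μν}(x)` belongs to `S`» translates. [cite: Balaban1985RegularSpaces, p.77 («Similarly for the corresponding set of plaquettes»), (1.2) p.76] -/
theorem plaqTouches_add_zsmul_iff {T : ℕ} {S : Set (B7Prop1Explicit.Site d)} (hS : IsPeriodic T (· ∈ S)) (x m : B7Prop1Explicit.Site d) (μ ν : Fin d) :
    PlaqTouches S (x + (T : ℤ) • m) μ ν ↔ PlaqTouches S x μ ν := by
  unfold PlaqTouches
  have h1 : x + (T : ℤ) • m + e μ = (x + e μ) + (T : ℤ) • m := add_right_comm _ _ _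
  have h2 : x + (T : ℤ) • m + e ν = (x + e ν) + (T : ℤ) • m := add_right_comm _ _ _
  have h3 : x + (T : ℤ) • m + e μ + e ν = (x + e μ + e ν) + (T : ℤ) • m := by abel
  rw [h3, h1, h2, isPeriodic_mem_iff hS, isPeriodic_mem_iff hS, isPeriodic_mem_iff hS, isPeriodic_mem_iff hS]

/-- «`⟨y, y + e_τ⟩` is a side of `p_{κν}(z)`» is translation-invariant (ANY translation `v`). [cite: Balaban1985RegularSpaces, (1.2) p.76 (definition of p_{μν}(x))] -/
theorem isSide_add_iff (z y v : B7Prop1Explicit.Site d) (κ ν τ : Fin d) : IsSide (z + v) κ ν (y + v) τ ↔ IsSide z κ ν y τ := by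
  unfold IsSide
  have h1 : y + v = z + v ↔ y = z := add_left_inj v
  have h2 : y + v = z + v + e κ ↔ y = z + e κ := by rw [add_right_comm_e, add_left_inj]
  have h3 : y + v = z + v + e ν ↔ y = z + e ν := by rw [add_right_comm_e, add_left_inj]
  rw [h1, h2, h3]

/-- ★ **«The bond `⟨y, y + e_τ⟩` is a side of a plaquette touching `S`» TRANSLATES BY THE PERIOD LATTICE**: `SideTouches S (y + T•m) τ ↔ SideTouches S y τ` for a `T`-periodic `S` — the consumer item of
dag-n05-c's `isPeriodic_mlogCfg` (the mask of the canonical exponent). [cite: Balaban1985RegularSpaces, p.77 («on Ω_j»: bonds of plaquettes touching Ω_j), (1.2) p.76, (1.36) p.82] -/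
theorem sideTouches_add_zsmul_iff {T : ℕ} {S : Set (B7Prop1Explicit.Site d)} (hS : IsPeriodic T (· ∈ S)) (y m : B7Prop1Explicit.Site d) (τ : Fin d) :
    SideTouches S (y + (T : ℤ) • m) τ ↔ SideTouches S y τ := by
  constructor
  · rintro ⟨z, κ, ν, hκν, hP, hs⟩
    refine ⟨z - (T : ℤ) • m, κ, ν, hκν, ?_, ?_⟩
    · have h := plaqTouches_add_zsmul_iff hS (z - (T : ℤ) • m) m κ ν
      rw [sub_add_cancel] at h
      exact h.1 hP
    · have h := isSide_add_iff (z - (T : ℤ) • m) y ((T : ℤ) • m) κ ν τ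
      rw [sub_add_cancel] at h
      exact h.1 hs
  · rintro ⟨z, κ, ν, hκν, hP, hs⟩
    exact ⟨z + (T : ℤ) • m, κ, ν, hκν, (plaqTouches_add_zsmul_iff hS z m κ ν).2 hP, (isSide_add_iff z y _ κ ν τ).2 hs⟩

/-- `SideTouches S · τ` is `T`-periodic for a `T`-periodic `S`. [cite: Balaban1985RegularSpaces, p.77 («on Ω_j»), (1.2) p.76] -/
theorem isPeriodic_sideTouches {T : ℕ} {S : Set (B7Prop1Explicit.Site d)} (hS : IsPeriodic T (· ∈ S)) (τ : Fin d) :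
    IsPeriodic T (fun y => SideTouches S y τ) :=
  fun y m => propext (sideTouches_add_zsmul_iff hS y m τ)

/-- ★ **THE MASK OF THE CANONICAL EXPONENT `B8LeafModelZd3.mlogCfg k η Ω U₁` TRANSLATES**: with `Ω_j` `T`-periodic for `j ≤ k`,
`(∃ j, j ≤ k ∧ SideTouches (Ω j) (y + T•m) τ) ↔ (∃ j, j ≤ k ∧ SideTouches (Ω j) y τ)`. [cite: Balaban1985RegularSpaces, (1.36) p.82 («U₁ = exp iηA … on Ω_j, j = 0, …, k»), p.77, p.89 («A₀ = (1/iη) log U′»)] -/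
theorem sideTouchesMask_add_zsmul_iff {T k : ℕ} {Ω : ℕ → Set (B7Prop1Explicit.Site d)} (hΩ : ∀ j, j ≤ k → IsPeriodic T (· ∈ Ω j)) (y m : B7Prop1Explicit.Site d) (τ : Fin d) :
    (∃ j, j ≤ k ∧ SideTouches (Ω j) (y + (T : ℤ) • m) τ) ↔ (∃ j, j ≤ k ∧ SideTouches (Ω j) y τ) :=
  exists_congr fun j => and_congr_right fun hj => sideTouches_add_zsmul_iff (hΩ j hj) y m τ

/-- The mask of `mlogCfg` is `T`-periodic in the site. [cite: Balaban1985RegularSpaces, (1.36) p.82, p.77] -/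
theorem isPeriodic_sideTouchesMask {T k : ℕ} {Ω : ℕ → Set (B7Prop1Explicit.Site d)} (hΩ : ∀ j, j ≤ k → IsPeriodic T (· ∈ Ω j)) (τ : Fin d) :
    IsPeriodic T (fun y => ∃ j, j ≤ k ∧ SideTouches (Ω j) y τ) :=
  fun y m => propext (sideTouchesMask_add_zsmul_iff hΩ y m τ)

/-- The p. 77 bond class `bondsOn Λ l` («at least one end-point in `Λ_l`», level-`l` labels) translates by the label period `Q` of `Λ l`. [cite: Balaban1985RegularSpaces, p.77 (bond convention), (1.35) p.82 («on Λ_j»)] -/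
theorem bondsOn_add_zsmul_iff {Q : ℕ} {Λ : ℕ → Set (B7Prop1Explicit.Site d)} {l : ℕ} (hΛ : IsPeriodic Q (· ∈ Λ l)) (y m : B7Prop1Explicit.Site d) (κ : Fin d) :
    (y + (Q : ℤ) • m, κ) ∈ bondsOn Λ l ↔ (y, κ) ∈ bondsOn Λ l := by
  rw [mem_bondsOn, mem_bondsOn, add_right_comm_e, isPeriodic_mem_iff hΛ, isPeriodic_mem_iff hΛ]

end Sites

/-! ## §2 Blocks: label shifts `Q` with fine period `T = Lˡ·Q` -/

section Blocks

/-- The tower corner `tlo` translates: `tlo L (z + v) l = tlo L z l + Lˡ•v`. [cite: Balaban1985RegularSpaces, (1.4) p.77 («Bʲ(Ω_j^{(j)})»; block corners)] -/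
theorem tlo_add_zsmul (L : ℕ) (z v : B7Prop1Explicit.Site d) : ∀ l : ℕ, tlo L (z + v) l = tlo L z l + ((L : ℤ) ^ l) • v
  | 0 => by simp [tlo]
  | l + 1 => by
    rw [tlo, tlo, tlo_add_zsmul L z v l, smul_add, smul_smul, pow_succ, mul_comm]

/-- The tower upper corner `thi` translates likewise. [cite: Balaban1985RegularSpaces, (1.4) p.77 (block corners)] -/
theorem thi_add_zsmul (L : ℕ) (z v : B7Prop1Explicit.Site d) : ∀ l : ℕ, thi L (z + v) l = thi L z l + ((L : ℤ) ^ l) • v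
  | 0 => by simp [thi]
  | l + 1 => by
    funext i
    have ih := congrFun (thi_add_zsmul L z v l) i
    simp only [thi, Pi.add_apply, Pi.smul_apply, smul_eq_mul, pow_succ] at ih ⊢
    rw [ih]
    ring

/-- «The `l`-block of the label `z + Q•m` lies in `S`» ↔ «the `l`-block of `z` lies in `S`» for a `T = Lˡ·Q`-periodic `S`. [cite: Balaban1985RegularSpaces, (1.4) p.77, p.77 («Ω_j ⊂ T_η»)] -/
theorem forall_inBox_tower_add_iff {L T Q l : ℕ} (hT : T = L ^ l * Q) {S : Set (B7Prop1Explicit.Site d)} (hS : IsPeriodic T (· ∈ S)) (z m : B7Prop1Explicit.Site d) :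
    (∀ x, InBox (tlo L (z + (Q : ℤ) • m) l) (thi L (z + (Q : ℤ) • m) l) x → x ∈ S) ↔ (∀ x, InBox (tlo L z l) (thi L z l) x → x ∈ S) := by
  have hc : ((L : ℤ) ^ l) • ((Q : ℤ) • m) = ((T : ℕ) : ℤ) • m := by rw [smul_smul, hT]; push_cast; ring_nf
  rw [tlo_add_zsmul, thi_add_zsmul, hc]
  exact forall_inBox_add_iff hS _ _ m

/-- ★ **THE END-BLOCK CLAUSE `EndBlockIn` TRANSLATES** (the (1.4)-collar ∕ (1.145) text «the block of one end-point of the level-`l` bond lies in `S`»): for `T = Lˡ·Q` and a `T`-periodic `S`,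
`EndBlockIn L S l (z + Q•m) μ ↔ EndBlockIn L S l z μ`. [cite: Balaban1985RegularSpaces, (1.4) p.77, (1.145) p.100, p.77 (bond convention)] -/
theorem endBlockIn_add_zsmul_iff {L T Q l : ℕ} (hT : T = L ^ l * Q) {S : Set (B7Prop1Explicit.Site d)} (hS : IsPeriodic T (· ∈ S)) (z m : B7Prop1Explicit.Site d) (μ : Fin d) :
    EndBlockIn L S l (z + (Q : ℤ) • m) μ ↔ EndBlockIn L S l z μ := by
  unfold EndBlockIn
  rw [add_right_comm_e, forall_inBox_tower_add_iff hT hS, forall_inBox_tower_add_iff hT hS]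

/-- ★ **THE PRINTED-CLASS BOND SET `towerBondsP L Ω Λ l` TRANSLATES** (dag-n06-b's P-class binders; box clauses at levels `l` and `l − 1`, inner clause (1.31), crossing clauses (1.37)): for
`T = Lˡ·Q`, `Ω_l` and `Ω_{l−1}` `T`-periodic, `Λ l` `Q`-periodic and `Λ (l−1)` `L·Q`-periodic, `(z + Q•m, κ) ∈ towerBondsP L Ω Λ l ↔ (z, κ) ∈ towerBondsP L Ω Λ l`.
[cite: Balaban1985RegularSpaces, (1.31) p.82, (1.37) p.82, p.86 («𝔅_k»), p.77 («Ω_j ⊂ T_η»)] -/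
theorem towerBondsP_add_zsmul_iff {L T Q : ℕ} {Ω Λ : ℕ → Set (B7Prop1Explicit.Site d)} {l : ℕ} (hT : T = L ^ l * Q) (hΩl : IsPeriodic T (· ∈ Ω l))
    (hΩp : IsPeriodic T (· ∈ Ω (l - 1))) (hΛ : IsPeriodic Q (· ∈ Λ l)) (hΛ' : ∀ l', l = l' + 1 → IsPeriodic (L * Q) (· ∈ Λ l')) (z m : B7Prop1Explicit.Site d) (κ : Fin d) :
    (z + (Q : ℤ) • m, κ) ∈ towerBondsP L Ω Λ l ↔ (z, κ) ∈ towerBondsP L Ω Λ l := by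
  have hc : ((L : ℤ) ^ l) * (Q : ℤ) = ((T : ℕ) : ℤ) := by rw [hT]; push_cast; ring
  have hLQ : (L : ℤ) * (Q : ℤ) = (((L * Q : ℕ)) : ℤ) := by push_cast; ring
  have hze : z + (Q : ℤ) • m + e κ = (z + e κ) + (Q : ℤ) • m := add_right_comm _ _ _
  show (_ ∧ _ ∧ _) ∨ (_ ∧ (_ ∨ _)) ↔ (_ ∧ _ ∧ _) ∨ (_ ∧ (_ ∨ _))
  refine or_congr (and_congr ?_ (and_congr (isPeriodic_mem_iff hΛ z m) ?_)) (and_congr ?_ (or_congr ?_ ?_))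
  · rw [loK_add_zsmul, bondHiK_add_zsmul, hc]
    exact forall_inBox_add_iff hΩl _ _ m
  · rw [hze]; exact isPeriodic_mem_iff hΛ _ m
  · rw [loK_add_zsmul, bondHiK_add_zsmul, hc]
    exact forall_inBox_add_iff hΩp _ _ m
  · refine exists_congr fun l' => and_congr_right fun hl' => and_congr ?_ ?_
    · rw [smul_add_zsmul, hLQ]
      exact forall_block_add_iff (hΛ' l' hl') _ _ m
    · rw [hze]; exact isPeriodic_mem_iff hΛ _ m
  · refine exists_congr fun l' => and_congr_right fun hl' => and_congr (isPeriodic_mem_iff hΛ z m) ?_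
    rw [hze, smul_add_zsmul, hLQ]
    exact forall_block_add_iff (hΛ' l' hl') _ _ m

/-- Every `κ`-section of `towerBondsP L Ω Λ l` is `Q`-periodic under the hypotheses of `towerBondsP_add_zsmul_iff`. [cite: Balaban1985RegularSpaces, (1.31) p.82, (1.37) p.82, p.86 («𝔅_k»)] -/
theorem isPeriodic_towerBondsP {L T Q : ℕ} {Ω Λ : ℕ → Set (B7Prop1Explicit.Site d)} {l : ℕ} (hT : T = L ^ l * Q) (hΩl : IsPeriodic T (· ∈ Ω l))
    (hΩp : IsPeriodic T (· ∈ Ω (l - 1))) (hΛ : IsPeriodic Q (· ∈ Λ l)) (hΛ' : ∀ l', l = l' + 1 → IsPeriodic (L * Q) (· ∈ Λ l')) (κ : Fin d) :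
    IsPeriodic Q (fun z => (z, κ) ∈ towerBondsP L Ω Λ l) :=
  fun z m => propext (towerBondsP_add_zsmul_iff hT hΩl hΩp hΛ hΛ' z m κ)

/-- **`towerBondsP` OF PRINT'S LEVEL SETS `B11Eq7Convention.Lam L Ω m` is `Q`-periodic from the Ω-periods alone** (`T = Lˡ·Q`; levels `l − 1`, `l`, and `l + 1` if `l < m`).
[cite: Balaban1985RegularSpaces, (1.5) p.77, (1.31) p.82, (1.37) p.82, p.86 («𝔅_k»)] -/
theorem isPeriodic_towerBondsP_lam {L T Q : ℕ} {Ω : ℕ → Set (B7Prop1Explicit.Site d)} {m l : ℕ} (hT : T = L ^ l * Q) (hlm : l ≤ m)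
    (hΩp : ∀ l', l' ≤ l - 1 → IsPeriodic T (· ∈ Ω l')) (hΩl : IsPeriodic T (· ∈ Ω l)) (hΩs : l < m → IsPeriodic T (· ∈ Ω (l + 1))) (κ : Fin d) :
    IsPeriodic Q (fun z => (z, κ) ∈ towerBondsP L Ω (B11Eq7Convention.Lam L Ω m) l) := by
  have hΩp' : IsPeriodic T (· ∈ Ω (l - 1)) := by
    rcases Nat.eq_zero_or_pos l with h0 | h0
    · subst h0; exact hΩl
    · exact hΩp (l - 1) le_rfl
  refine isPeriodic_towerBondsP hT hΩl hΩp' (isPeriodic_lamK hT hΩl hΩs) (fun l' hl' => ?_) κ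
  subst hl'
  have hT' : T = L ^ l' * (L * Q) := by rw [hT]; ring
  exact isPeriodic_lamK hT' (hΩp l' (by omega)) fun _ => hΩl

end Blocks

/-! ## §3 On the index of record: `towerBondsP` over a (1.5)-member's constraint families -/

section SubD

variable {θ : Stage3Params}

/-- **At a (1.5)-member with `T`-periodic domains (`l ≤ m ≤ k`, `T = θ.Lˡ·Q`) dag-n06-b's printed-class bond set over the member's families translates**:
`(z + Q•m', κ) ∈ towerBondsP θ.L Ω (Λs m) l ↔ (z, κ) ∈ towerBondsP θ.L Ω (Λs m) l` (rigidity `Λs m = Lam θ.L Ω m`, p621462, + §2). [cite: Balaban1985RegularSpaces, (1.31) p.82, (1.37) p.82, p.86 («𝔅_k»), (1.5) p.77] -/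
theorem IdxB8SubD.towerBondsP_Λs_add_zsmul_iff (j : IdxB8SubD θ) {T : ℕ} (hΩ : ∀ l, l ≤ j.1.1.1.1.k → IsPeriodic T (· ∈ j.1.1.1.1.Ω l))
    {m : ℕ} (hm : m ≤ j.1.1.1.1.k) {l : ℕ} (hl : l ≤ m) {Q : ℕ} (hT : T = θ.L ^ l * Q) (z m' : B7Prop1Explicit.Site θ.D) (κ : Fin θ.D) :
    (z + (Q : ℤ) • m', κ) ∈ towerBondsP θ.L j.1.1.1.1.Ω (j.1.1.1.1.Λs m) l ↔ (z, κ) ∈ towerBondsP θ.L j.1.1.1.1.Ω (j.1.1.1.1.Λs m) l := by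
  refine towerBondsP_add_zsmul_iff hT (hΩ l (by omega)) (hΩ (l - 1) (by omega))
    (B8IdxB8SubDPeriodicTowers.IdxB8SubD.isPeriodic_Λs j hΩ hm hl hT) (fun l' hl' => ?_) z m' κ
  subst hl'
  have hT' : T = θ.L ^ l' * (θ.L * Q) := by rw [hT]; ring
  exact B8IdxB8SubDPeriodicTowers.IdxB8SubD.isPeriodic_Λs j hΩ hm (by omega) hT'

/-- … hence every `κ`-section of `towerBondsP θ.L Ω (Λs m) l` at such a member is `Q`-periodic. [cite: Balaban1985RegularSpaces, (1.31) p.82, (1.37) p.82, p.86 («𝔅_k»), (1.5) p.77] -/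
theorem IdxB8SubD.isPeriodic_towerBondsP_Λs (j : IdxB8SubD θ) {T : ℕ} (hΩ : ∀ l, l ≤ j.1.1.1.1.k → IsPeriodic T (· ∈ j.1.1.1.1.Ω l))
    {m : ℕ} (hm : m ≤ j.1.1.1.1.k) {l : ℕ} (hl : l ≤ m) {Q : ℕ} (hT : T = θ.L ^ l * Q) (κ : Fin θ.D) :
    IsPeriodic Q (fun z => (z, κ) ∈ towerBondsP θ.L j.1.1.1.1.Ω (j.1.1.1.1.Λs m) l) :=
  fun z m' => propext (IdxB8SubD.towerBondsP_Λs_add_zsmul_iff j hΩ hm hl hT z m' κ)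

end SubD

end Literature.MathematicalPhysics.QuantumFieldTheory.Balaban1983to89.B8PeriodicMemberGeometry

end
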